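import Mathlib
import Summits.Ventures.HodgeRepro2.T5HodgeStar
import Summits.Ventures.HodgeRepro2.T5OneCovectorNormalisation
import Summits.Ventures.HodgeRepro2.T5OneCovectorWedge

/-!
# The Hodge operator in degrees 1 and 3 of the coframe model: Lemma 5.5 at the odd degrees

Tier-5 support for sub-step N1 (Hodge-theoretic side, route/T5-N1-hodge-p6.md §H1 (V3, V4),
§H2.1).  `T5HodgeStar` models the Hodge operator of Voisin's Definition 5.3
[Hodge Theory I, p0104 ll. 30–38] on the 2-covectors of an oriented euclidean 4-space
(a point of a surface) and checks «Lemma 5.5 The operator `*` satisfies the identity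
`*² = (−1)^{k(n−k)}` on `A^k(X)`» [p0104 ll. 48–51] at `k = 2`, `n = 4` (`*² = 1`), and the
characterisation «`(α_x, β_x) Vol_x = α_x ∧ \overline{*β}_x`» [p0105 l. 8] there.  This file
does the same at the two odd degrees of the same 4-space: with the orthonormal coframe
`f = (f₀, f₁, f₂, f₃) = (dx₁, dy₁, dx₂, dy₂)` and `Vol = f₀∧f₁∧f₂∧f₃`,

* a 3-covector is written in the basis `ê_i := f_j ∧ f_k ∧ f_l` (`j < k < l`, `{j,k,l} = {0,1,2,3} ∖ {i}`),
  so `f_i ∧ ê_i = (−1)^i Vol` and `ê_i ∧ f_i = (−1)^{i+1} Vol`;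
* `* f_i = (−1)^i ê_i` and `* ê_i = (−1)^{i+1} f_i` (the unique operators with
  `γ ∧ *δ = (γ, δ) Vol`, the orthonormal bases `f_i`, `ê_i` — p0104 l. 7);
* `*² = −1` on `Λ¹` and on `Λ³` (Lemma 5.5 with `k(n−k) = 3`), the characterisation
  `γ ∧ \overline{*δ} = (γ, δ) Vol` in both degrees, and its uniqueness (the pairing
  `Λ¹ × Λ³ → ℂ` is non-degenerate, as `T5HodgeStarUnique` records in degree 2).

Degrees 0 and 4 are the identity on the single coefficient (`*1 = Vol`, `*Vol = 1`, `*² = 1`);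
with `T5HodgeStar.hodgeStar_hodgeStar` this completes the check of Lemma 5.5 at every degree
of a surface.  The manifold and the bundles stay prose.
-/

namespace Summit.Ventures.HodgeRepro2.T5HodgeStarOddDegree

open Complex T5HodgeStar T5OneCovectorNormalisation T5OneCovectorWedge

/-- The complex 3-covectors at a point of the surface, in the basis `ê₀, ê₁, ê₂, ê₃` with
`ê_i` the wedge (in increasing order) of the three coframe elements other than `f_i`:
`ê₀ = f₁∧f₂∧f₃`, `ê₁ = f₀∧f₂∧f₃`, `ê₂ = f₀∧f₁∧f₃`, `ê₃ = f₀∧f₁∧f₂`. -/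
abbrev ThreeCovector := Fin 4 → ℂ

/-- The sign `ε_i = (−1)^i` with `f_i ∧ ê_i = ε_i Vol` (moving `f_i` past the `i` coframe
elements preceding it). -/
def sgn (i : Fin 4) : ℂ := (-1) ^ (i : ℕ)

/-- The Vol-coefficient of `u ∧ w` for `u ∈ Λ¹`, `w ∈ Λ³`: `Σ_i ε_i u_i w_i`. -/
def wedge13 (u : OneCovector) (w : ThreeCovector) : ℂ :=
  u 0 * w 0 - u 1 * w 1 + u 2 * w 2 - u 3 * w 3

/-- The Vol-coefficient of `w ∧ u` for `w ∈ Λ³`, `u ∈ Λ¹`: `ê_i ∧ f_i = (−1)^{3−i} Vol`, i.e.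
`−Σ_i ε_i w_i u_i`. -/
def wedge31 (w : ThreeCovector) (u : OneCovector) : ℂ :=
  -(w 0 * u 0) + w 1 * u 1 - w 2 * u 2 + w 3 * u 3

/-- The Hodge operator `Λ¹ → Λ³`: `* f_i = ε_i ê_i`, so that `f_i ∧ * f_i = Vol`. -/
def hodgeStar1 (u : OneCovector) : ThreeCovector := ![u 0, -u 1, u 2, -u 3]

/-- The Hodge operator `Λ³ → Λ¹`: `* ê_i = −ε_i f_i`, so that `ê_i ∧ * ê_i = Vol`. -/
def hodgeStar3 (w : ThreeCovector) : OneCovector := ![-w 0, w 1, -w 2, w 3]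

/-- Coefficientwise conjugation of a 3-covector. -/
def conj3 (w : ThreeCovector) : ThreeCovector := fun i => (starRingEnd ℂ) (w i)

/-- The hermitian extension of the metric on `Λ³` in which `ê₀, …, ê₃` are orthonormal
(Voisin p0104 l. 7 for `k = 3`). -/
def herm3 (w w' : ThreeCovector) : ℂ := ∑ i, w i * (starRingEnd ℂ) (w' i)

/-- `ε_i = (−1)^i` explicitly. -/
theorem sgn_eq : sgn = ![1, -1, 1, -1] := by
  ext i; fin_cases i <;> simp [sgn]
  norm_num

/-- `wedge13 u w = Σ_i ε_i u_i w_i`. -/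
theorem wedge13_eq_sum (u : OneCovector) (w : ThreeCovector) :
    wedge13 u w = ∑ i, sgn i * (u i * w i) := by
  simp [wedge13, sgn_eq, Fin.sum_univ_four]; ring

/-- Graded commutativity in the model: `w ∧ u = (−1)^{3·1} u ∧ w`. -/
theorem wedge31_eq_neg_wedge13 (w : ThreeCovector) (u : OneCovector) :
    wedge31 w u = -wedge13 u w := by
  simp [wedge31, wedge13]; ring

/-! ### Lemma 5.5 at the odd degrees -/

/-- **Lemma 5.5 at `k = 1`** (`n = 4`): `*² = (−1)^{1·3} = −1` on `Λ¹`. -/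
theorem hodgeStar3_hodgeStar1 (u : OneCovector) : hodgeStar3 (hodgeStar1 u) = -u := by
  ext i; fin_cases i <;> simp [hodgeStar1, hodgeStar3]

/-- **Lemma 5.5 at `k = 3`** (`n = 4`): `*² = (−1)^{3·1} = −1` on `Λ³`. -/
theorem hodgeStar1_hodgeStar3 (w : ThreeCovector) : hodgeStar1 (hodgeStar3 w) = -w := by
  ext i; fin_cases i <;> simp [hodgeStar1, hodgeStar3]

/-- `*` on `Λ¹` is `ℂ`-linear (additive). -/
theorem hodgeStar1_add (u v : OneCovector) : hodgeStar1 (u + v) = hodgeStar1 u + hodgeStar1 v := by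
  ext i; fin_cases i <;> simp [hodgeStar1] <;> ring

/-- `*` on `Λ¹` is `ℂ`-linear (homogeneous). -/
theorem hodgeStar1_smul (c : ℂ) (u : OneCovector) : hodgeStar1 (c • u) = c • hodgeStar1 u := by
  ext i; fin_cases i <;> simp [hodgeStar1]

/-- `*` on `Λ¹` commutes with conjugation (it is the `ℂ`-linear extension of a real operator,
Voisin p0105 l. 6). -/
theorem hodgeStar1_conj1 (u : OneCovector) : hodgeStar1 (conj1 u) = conj3 (hodgeStar1 u) := by
  ext i; fin_cases i <;> simp [hodgeStar1, conj1, conj3]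

/-- `*` on `Λ³` commutes with conjugation. -/
theorem hodgeStar3_conj3 (w : ThreeCovector) : hodgeStar3 (conj3 w) = conj1 (hodgeStar3 w) := by
  ext i; fin_cases i <;> simp [hodgeStar3, conj1, conj3]

/-! ### Definition 5.3 / p0105 l. 8 at the odd degrees, and uniqueness -/

/-- The real form of Lemma 5.4 pointwise at `k = 1`: `u ∧ *v = (Σ_i u_i v_i) Vol`. -/
theorem wedge13_hodgeStar1 (u v : OneCovector) : wedge13 u (hodgeStar1 v) = ∑ i, u i * v i := by
  simp [wedge13, hodgeStar1, Fin.sum_univ_four]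

/-- **The characterisation `γ ∧ \overline{*δ} = (γ, δ) Vol` at `k = 1`** (Voisin p0105 l. 8):
`wedge13 u (conj (* v)) = h₁(u, v)` with `h₁` the hermitian metric of
`T5OneCovectorNormalisation` (the four coframe elements orthonormal). -/
theorem wedge13_conj3_hodgeStar1 (u v : OneCovector) :
    wedge13 u (conj3 (hodgeStar1 v)) = herm1 u v := by
  simp [wedge13, hodgeStar1, conj3, herm1, Fin.sum_univ_four]

/-- The real form of Lemma 5.4 pointwise at `k = 3`: `w ∧ *w' = (Σ_i w_i w'_i) Vol`. -/
theorem wedge31_hodgeStar3 (w w' : ThreeCovector) :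
    wedge31 w (hodgeStar3 w') = ∑ i, w i * w' i := by
  simp [wedge31, hodgeStar3, Fin.sum_univ_four]

/-- **The characterisation at `k = 3`**: `wedge31 w (conj (* w')) = h₃(w, w')`. -/
theorem wedge31_conj1_hodgeStar3 (w w' : ThreeCovector) :
    wedge31 w (conj1 (hodgeStar3 w')) = herm3 w w' := by
  simp [wedge31, hodgeStar3, conj1, herm3, Fin.sum_univ_four]

/-- The pairing `Λ¹ × Λ³ → ℂ` is non-degenerate in its second variable: `u ∧ w = 0` for every
`u` forces `w = 0` (test against the coframe elements `f_i`). -/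
theorem wedge13_eq_zero_forall_iff (w : ThreeCovector) :
    (∀ u : OneCovector, wedge13 u w = 0) ↔ w = 0 := by
  constructor
  · intro h
    ext i
    fin_cases i
    · simpa [wedge13] using h ![1, 0, 0, 0]
    · simpa [wedge13] using h ![0, 1, 0, 0]
    · simpa [wedge13] using h ![0, 0, 1, 0]
    · simpa [wedge13] using h ![0, 0, 0, 1]
  · rintro rfl u; simp [wedge13]

/-- `wedge13` is additive in the second variable. -/
theorem wedge13_sub_right (u : OneCovector) (w w' : ThreeCovector) :
    wedge13 u (w - w') = wedge13 u w - wedge13 u w' := by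
  simp [wedge13]; ring

/-- **Uniqueness of `*` on `Λ¹`** (Definition 5.3 determines the operator): any
`T : Λ¹ → Λ³` with `u ∧ \overline{T v} = h₁(u, v)` for all `u, v` is `hodgeStar1`. -/
theorem hodgeStar1_unique (T : OneCovector → ThreeCovector)
    (hT : ∀ u v, wedge13 u (conj3 (T v)) = herm1 u v) : T = hodgeStar1 := by
  funext v
  have h : ∀ u, wedge13 u (conj3 (T v) - conj3 (hodgeStar1 v)) = 0 := by
    intro u
    rw [wedge13_sub_right, hT, wedge13_conj3_hodgeStar1, sub_self]
  have h' := (wedge13_eq_zero_forall_iff _).mp h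
  have h'' : conj3 (T v) = conj3 (hodgeStar1 v) := sub_eq_zero.mp h'
  ext i
  have := congrFun h'' i
  simp only [conj3] at this
  exact (starRingEnd ℂ).injective this

/-- The pairing is non-degenerate in its first variable as well. -/
theorem wedge31_eq_zero_forall_iff (u : OneCovector) :
    (∀ w : ThreeCovector, wedge31 w u = 0) ↔ u = 0 := by
  constructor
  · intro h
    ext i
    fin_cases i
    · simpa [wedge31] using h ![1, 0, 0, 0]
    · simpa [wedge31] using h ![0, 1, 0, 0]
    · simpa [wedge31] using h ![0, 0, 1, 0]
    · simpa [wedge31] using h ![0, 0, 0, 1]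
  · rintro rfl w; simp [wedge31]

/-- `wedge31` is additive in the second variable. -/
theorem wedge31_sub_right (w : ThreeCovector) (u u' : OneCovector) :
    wedge31 w (u - u') = wedge31 w u - wedge31 w u' := by
  simp [wedge31]; ring

/-- **Uniqueness of `*` on `Λ³`**: any `T : Λ³ → Λ¹` with `w ∧ \overline{T w'} = h₃(w, w')`
for all `w, w'` is `hodgeStar3`. -/
theorem hodgeStar3_unique (T : ThreeCovector → OneCovector)
    (hT : ∀ w w', wedge31 w (conj1 (T w')) = herm3 w w') : T = hodgeStar3 := by
  funext w'
  have h : ∀ w, wedge31 w (conj1 (T w') - conj1 (hodgeStar3 w')) = 0 := by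
    intro w
    rw [wedge31_sub_right, hT, wedge31_conj1_hodgeStar3, sub_self]
  have h' := (wedge31_eq_zero_forall_iff _).mp h
  have h'' : conj1 (T w') = conj1 (hodgeStar3 w') := sub_eq_zero.mp h'
  ext i
  have := congrFun h'' i
  simp only [conj1] at this
  exact (starRingEnd ℂ).injective this

/-! ### Numbers of record: `*` on the `(1,0)`-covectors -/

/-- `* dz₁ = ê₀ − i ê₁ = f₁∧f₂∧f₃ − i f₀∧f₂∧f₃ = −i dz₁ ∧ dx₂ ∧ dy₂` (a `(2,1)`-covector, as
`* : Λ^{1,0} → Λ^{n,n−1} = Λ^{2,1}` on a surface). -/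
theorem hodgeStar1_dz_zero : hodgeStar1 (dz 0) = ![1, -I, 0, 0] := by
  rw [dz_zero]; ext i; fin_cases i <;> simp [hodgeStar1]

/-- `* dz₂ = ê₂ − i ê₃ = f₀∧f₁∧f₃ − i f₀∧f₁∧f₂ = −i dx₁ ∧ dy₁ ∧ dz₂`. -/
theorem hodgeStar1_dz_one : hodgeStar1 (dz 1) = ![0, 0, 1, -I] := by
  rw [dz_one]; ext i; fin_cases i <;> simp [hodgeStar1]

/-- `h₁(u, u) Vol = u ∧ \overline{* u}` is real and non-negative: `Σ_i |u_i|²`. -/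
theorem wedge13_conj3_hodgeStar1_self (u : OneCovector) :
    wedge13 u (conj3 (hodgeStar1 u)) = ((∑ i, Complex.normSq (u i) : ℝ) : ℂ) := by
  rw [wedge13_conj3_hodgeStar1]; simp [herm1, Complex.mul_conj]

end Summit.Ventures.HodgeRepro2.T5HodgeStarOddDegree
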